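import Mathlib.Analysis.Calculus.ContDiff.Operations
import Mathlib.Analysis.Calculus.FDeriv.Equiv
import Mathlib.Topology.OpenPartialHomeomorph.Basic
import HarnessLib

/-!
# Conjugating a stage map by source and target charts

Topic `Literature/Topology/FourManifolds`; bookkeeping for the downward sweep of the smoothing of PD
homeomorphisms (Munkres, Ann. of Math. 72 (1960), §5; Campbell–D'Onofrio–Vítek, J. Geom. Anal.
(2026), §4).  The zone constructions (`TubeStage.lean`, `CreaseSmoothing.lean`) act on maps of
the product `E × F`; in the sweep they are applied to the current map `g : H → H'` between the
smooth source and target charts through a **source chart** `Θ` (an open partial homeomorphism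
`E × F ⇀ H`, smooth with smooth inverse) and a **target chart** `Θ'`: the map in coordinates is
`u = Θ'.symm ∘ g ∘ Θ`, the stage produces `Φ` from `u`, and the new global map is the **hard
switch**

  `conjStage Θ Θ' Φ S g = S.piecewise (Θ' ∘ Φ ∘ Θ.symm) g`

on a set `S ⊆ H` (the image of the open tube).  We prove: two-sided smooth partial homeomorphisms
have invertible derivatives (`exists_hasFDerivAt_equiv_of_symm`); on the open set `S` the new map
is locally the conjugate (`conjStage_eventuallyEq`), hence `C^∞` with invertible derivative there
when `Φ` is (`contDiffAt_conjStage`, `exists_hasFDerivAt_equiv_conjStage`); and where `Φ` agrees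
with `u` the new map agrees with `g` (`conjStage_eq_self_of_eq`).  Everything is proved; the one
definition is an explicit function; no named facts.

## References

* J. R. Munkres, *Obstructions to the smoothing of piecewise-differentiable homeomorphisms*, Ann.
  of Math. (2) 72 (1960), 521–554, §5. [Munkres1960]
* D. Campbell, L. D'Onofrio, T. Vítek, *Diffeomorphic approximation of piecewise affine
  homeomorphisms*, J. Geom. Anal. 36 (2026), §4. [CampbellDonofrioVitek2026]
-/

noncomputable section

open Set Function Filter
open scoped Topology ContDiff Classical

namespace Literature.Topology.FourManifolds

variable {P : Type*} [NormedAddCommGroup P] [NormedSpace ℝ P]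
variable {H : Type*} [NormedAddCommGroup H] [NormedSpace ℝ H]
variable {H' : Type*} [NormedAddCommGroup H'] [NormedSpace ℝ H']

/-- `∞ ≠ 0` (bookkeeping). [folklore] -/
private theorem sic_infty_ne_zero : (∞ : WithTop ℕ∞) ≠ 0 := by
  simp

/-! ### Two-sided smooth partial homeomorphisms have invertible derivatives -/

/-- **A partial homeomorphism which is `C^∞` together with its inverse has an invertible
derivative** at every point of its source: `DΘ(p)` is a continuous linear equivalence with inverse
`D(Θ.symm)(Θ p)` (chain rule on `Θ.symm ∘ Θ = id` near `p` and `Θ ∘ Θ.symm = id` near `Θ p`).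
[folklore] -/
theorem exists_hasFDerivAt_equiv_of_symm (Θ : OpenPartialHomeomorph P H)
    (hΘ : ContDiffOn ℝ ∞ Θ Θ.source) (hΘs : ContDiffOn ℝ ∞ Θ.symm Θ.target) {p : P} (hp : p ∈ Θ.source) :
    ∃ L : P ≃L[ℝ] H, HasFDerivAt Θ (L : P →L[ℝ] H) p ∧ HasFDerivAt Θ.symm (L.symm : H →L[ℝ] P) (Θ p) := by
  have hp' : Θ p ∈ Θ.target := Θ.map_source hp
  have hA : HasFDerivAt Θ (fderiv ℝ Θ p) p :=
    ((hΘ.contDiffAt (Θ.open_source.mem_nhds hp)).differentiableAt sic_infty_ne_zero).hasFDerivAt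
  have hB : HasFDerivAt Θ.symm (fderiv ℝ Θ.symm (Θ p)) (Θ p) :=
    ((hΘs.contDiffAt (Θ.open_target.mem_nhds hp')).differentiableAt sic_infty_ne_zero).hasFDerivAt
  set A := fderiv ℝ Θ p with hAdef
  set B := fderiv ℝ Θ.symm (Θ p) with hBdef
  -- `B ∘ A = id`
  have h1 : B.comp A = ContinuousLinearMap.id ℝ P := by
    have hc : HasFDerivAt (Θ.symm ∘ Θ) (B.comp A) p := hB.comp p hA
    have hid : HasFDerivAt (Θ.symm ∘ Θ) (ContinuousLinearMap.id ℝ P) p := by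
      refine (hasFDerivAt_id p).congr_of_eventuallyEq ?_
      filter_upwards [Θ.open_source.mem_nhds hp] with q hq
      exact Θ.left_inv hq
    exact hc.unique hid
  -- `A ∘ B = id`
  have h2 : A.comp B = ContinuousLinearMap.id ℝ H := by
    have hA' : HasFDerivAt Θ A (Θ.symm (Θ p)) := by rw [Θ.left_inv hp]; exact hA
    have hc : HasFDerivAt (Θ ∘ Θ.symm) (A.comp B) (Θ p) := hA'.comp (Θ p) hB
    have hid : HasFDerivAt (Θ ∘ Θ.symm) (ContinuousLinearMap.id ℝ H) (Θ p) := by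
      refine (hasFDerivAt_id (Θ p)).congr_of_eventuallyEq ?_
      filter_upwards [Θ.open_target.mem_nhds hp'] with z hz
      exact Θ.right_inv hz
    exact hc.unique hid
  let L : P ≃L[ℝ] H := ContinuousLinearEquiv.equivOfInverse A B
    (fun x => by have := congrArg (fun T : P →L[ℝ] P => T x) h1; simpa using this)
    (fun y => by have := congrArg (fun T : H →L[ℝ] H => T y) h2; simpa using this)
  refine ⟨L, ?_, ?_⟩
  · exact hA
  · have : (L.symm : H →L[ℝ] P) = B := ContinuousLinearMap.ext fun y => rfl
    rw [this]; exact hB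

/-! ### The conjugated stage -/

/-- **The conjugated stage**: on `S` the conjugate `Θ' ∘ Φ ∘ Θ.symm` of the stage map `Φ`,
elsewhere the old map `g` (hard switch). [folklore] -/
def conjStage (Θ : OpenPartialHomeomorph P H) (Θ' : OpenPartialHomeomorph P H') (Φ : P → P)
    (S : Set H) (g : H → H') : H → H' :=
  S.piecewise (fun z => Θ' (Φ (Θ.symm z))) g

variable {Θ : OpenPartialHomeomorph P H} {Θ' : OpenPartialHomeomorph P H'} {Φ : P → P} {S : Set H}
  {g : H → H'} {z : H}

omit [NormedSpace ℝ P] [NormedSpace ℝ H] [NormedSpace ℝ H'] in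
/-- On `S` the conjugated stage is the conjugate. [folklore] -/
theorem conjStage_of_mem (hz : z ∈ S) : conjStage Θ Θ' Φ S g z = Θ' (Φ (Θ.symm z)) :=
  Set.piecewise_eq_of_mem _ _ _ hz

omit [NormedSpace ℝ P] [NormedSpace ℝ H] [NormedSpace ℝ H'] in
/-- Off `S` the conjugated stage is the old map. [folklore] -/
theorem conjStage_of_not_mem (hz : z ∉ S) : conjStage Θ Θ' Φ S g z = g z :=
  Set.piecewise_eq_of_notMem _ _ _ hz

omit [NormedSpace ℝ P] [NormedSpace ℝ H] [NormedSpace ℝ H'] in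
/-- Near a point of the open set `S` the conjugated stage is the conjugate. [folklore] -/
theorem conjStage_eventuallyEq (hS : IsOpen S) (hz : z ∈ S) :
    conjStage Θ Θ' Φ S g =ᶠ[𝓝 z] fun w => Θ' (Φ (Θ.symm w)) := by
  filter_upwards [hS.mem_nhds hz] with w hw
  exact conjStage_of_mem hw

omit [NormedSpace ℝ P] [NormedSpace ℝ H] [NormedSpace ℝ H'] in
/-- Near a point of the open complement-interior the conjugated stage is the old map.
[folklore] -/
theorem conjStage_eventuallyEq_self (hz : z ∈ interior Sᶜ) :
    conjStage Θ Θ' Φ S g =ᶠ[𝓝 z] g := by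
  filter_upwards [isOpen_interior.mem_nhds hz] with w hw
  exact conjStage_of_not_mem (interior_subset hw)

omit [NormedSpace ℝ P] [NormedSpace ℝ H] [NormedSpace ℝ H'] in
/-- **Where the stage agrees with the map in coordinates, the conjugated stage agrees with the
old map**: if `Φ q = Θ'.symm (g (Θ q))` at `q = Θ.symm z` with `z ∈ Θ.target` and
`g z ∈ Θ'.target`, then `conjStage … z = g z` (whether or not `z ∈ S`). [folklore] -/
theorem conjStage_eq_self_of_eq (hzt : z ∈ Θ.target) (hgz : g z ∈ Θ'.target)
    (hΦ : Φ (Θ.symm z) = Θ'.symm (g (Θ (Θ.symm z)))) : conjStage Θ Θ' Φ S g z = g z := by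
  by_cases hz : z ∈ S
  · rw [conjStage_of_mem hz, hΦ, Θ.right_inv hzt, Θ'.right_inv hgz]
  · exact conjStage_of_not_mem hz

/-- **Smoothness of the conjugated stage on `S`**: `S` open inside `Θ.target`, `Θ.symm` smooth
on `Θ.target`, `Φ` smooth at `q = Θ.symm z` with `Φ q ∈ Θ'.source`, `Θ'` smooth on its source.
[folklore] -/
theorem contDiffAt_conjStage (hS : IsOpen S) (hz : z ∈ S) (hST : S ⊆ Θ.target)
    (hΘs : ContDiffOn ℝ ∞ Θ.symm Θ.target) (hΦ : ContDiffAt ℝ ∞ Φ (Θ.symm z))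
    (hΦq : Φ (Θ.symm z) ∈ Θ'.source) (hΘ' : ContDiffOn ℝ ∞ Θ' Θ'.source) :
    ContDiffAt ℝ ∞ (conjStage Θ Θ' Φ S g) z := by
  refine ContDiffAt.congr_of_eventuallyEq ?_ (conjStage_eventuallyEq hS hz)
  have h1 : ContDiffAt ℝ ∞ Θ.symm z := hΘs.contDiffAt (Θ.open_target.mem_nhds (hST hz))
  have h2 : ContDiffAt ℝ ∞ Θ' (Φ (Θ.symm z)) := hΘ'.contDiffAt (Θ'.open_source.mem_nhds hΦq)
  exact h2.comp z (hΦ.comp z h1)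

/-- **Invertible derivative of the conjugated stage on `S`**: with the charts two-sided smooth and
`Φ` having an invertible derivative at `q = Θ.symm z`, the conjugated stage has the invertible
derivative `DΘ'(Φ q) ∘ DΦ(q) ∘ DΘ.symm(z)`. [folklore] -/
theorem exists_hasFDerivAt_equiv_conjStage (hS : IsOpen S) (hz : z ∈ S) (hST : S ⊆ Θ.target)
    (hΘ : ContDiffOn ℝ ∞ Θ Θ.source) (hΘs : ContDiffOn ℝ ∞ Θ.symm Θ.target)
    (hΘ' : ContDiffOn ℝ ∞ Θ' Θ'.source) (hΘ's : ContDiffOn ℝ ∞ Θ'.symm Θ'.target)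
    (hΦq : Φ (Θ.symm z) ∈ Θ'.source)
    (hΦ : ∃ L : P ≃L[ℝ] P, HasFDerivAt Φ (L : P →L[ℝ] P) (Θ.symm z)) :
    ∃ L : H ≃L[ℝ] H', HasFDerivAt (conjStage Θ Θ' Φ S g) (L : H →L[ℝ] H') z := by
  obtain ⟨LΦ, hLΦ⟩ := hΦ
  -- the source chart at `q = Θ.symm z`: `z = Θ q`
  have hq : Θ.symm z ∈ Θ.source := Θ.map_target (hST hz)
  obtain ⟨LΘ, -, hLΘs⟩ := exists_hasFDerivAt_equiv_of_symm Θ hΘ hΘs hq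
  rw [Θ.right_inv (hST hz)] at hLΘs
  -- the target chart at `Φ q`
  obtain ⟨LΘ', hLΘ', -⟩ := exists_hasFDerivAt_equiv_of_symm Θ' hΘ' hΘ's hΦq
  refine ⟨(LΘ.symm.trans LΦ).trans LΘ', ?_⟩
  refine HasFDerivAt.congr_of_eventuallyEq ?_ (conjStage_eventuallyEq hS hz)
  have hc := hLΘ'.comp z (hLΦ.comp z hLΘs)
  refine hc.congr_fderiv (ContinuousLinearMap.ext fun v => ?_)
  rfl

end Literature.Topology.FourManifolds
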